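import Summits.AnomalousDissipation.AnomalousDissipation.Theorems.SolenoidalFractalHomogenisationLagrangianStepCellChainDefs
import Summits.AnomalousDissipation.AnomalousDissipation.Theorems.SolenoidalFractalHomogenisationPermissibleFractalCarrierTime
import Literature.Analysis.FluidPDE.PassiveVectorTensorDuality
import Literature.Analysis.FluidPDE.PassiveVectorTensorUniqueness
import Literature.Analysis.FunctionSpaces.TorusVectorParseval
import Mathlib.MeasureTheory.Integral.IntervalIntegral.AbsolutelyContinuousFun
import HarnessLib

/-!
# K1L_D `LagrangianRenormalisationStepDesign` (stmt-AnomalousDissipation-27980), W7 engine sub-piece S1a / `stub_cellLawV0_IS` V0: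
# the MODES of a weak solution of the flat tensor cell problem as absolutely continuous functions of time with the CHAIN ODE as
# a.e. derivative (helper; `--supports stmt-AnomalousDissipation-27980`)

Summits-side helper file of route `SolenoidalFractalHomogenisation` (prover seat `ad-k1l-cellLawV-w1` g4; W7 engine plan of record planner
ad-ideate-p4 g13 `Cruxes/…/Lines/onelevel-W7-threemode.md` §5 S1; regularity interface agreed with the assembly owner ad-sawtooth-k1loc-p1 g11 and
p5 g10's AC Grönwall `…W7EngineSpineAC`).  Everything proved; no definitions (those are `…CellChainDefs`: `linkCoeff`, `modeRHS`, `modeRep`), no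
named facts, no sorry.  Setting: `h : Torus.IsWeakTensorPassiveVectorOn 0 T 𝔹 (W₁.cell n) F u`, `F ∈ L¹`; `û(t) = 𝓕(complexify ∘ u t)`.

* §1 algebra of the chain right-hand side: `kdot_modeRHS` (it is transversal), `inner_modeRHS_eq` (its pairing with a transversal `z` is the scalar
  integrand of `CellChainLinks.ae_inner_mFourierCoeff_eq_cell`: `−4π²⟪û(k), T_𝔹(k)z⟫ + Σⱼ linkCoeffⱼ·(a′ⱼ⟪û(k−Kⱼ),z⟫ + aⱼ⟪û(k+Kⱼ),z⟫)`);
* §2 `integrableOn_modeRHS`: `modeRHS … k ∈ L¹(0,T)` (modes of a weak solution are integrable in time, the link coefficients are bounded continuous);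
* §3 THE REPRESENTATIVE: `continuousOn_modeRep` (on `[0,T]`), `kdot_modeRep` (transversal), **`ae_eq_modeRep`** (`û(t)(k) = modeRep … k t` for a.e.
  `t ∈ (0,T)` — the VECTOR form of the chain identity), `ae_forall_eq_modeRep` (all modes at once), **`ae_hasDerivAt_modeRep`**
  (`HasDerivAt (modeRep … k) (modeRHS … k t) t` for a.e. `t ∈ (0,T)`, Lebesgue differentiation), `ae_hasDerivAt_modeRep_rep` (the same with the
  right-hand side read on the representatives: a closed countable ODE system satisfied a.e.);
* §4 `sum_sq_norm_le_integral` (finite Bessel, a.e. in time) and **`absolutelyContinuousOnInterval_modeRep`** (AC on every `[a,b] ⊆ [0,T]`,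
  via the dominated-AC lemma `absolutelyContinuousOnInterval_of_dist_le` and Mathlib's AC of real primitives) — exactly the regularity consumed by
  `AbsolutelyContinuousOnInterval.integral_deriv_eq_sub` in the per-slot Grönwall step (S3) of the W7 engine.
The single-slot / gauged three-mode shape (`dW0C/dWpC/dWmC`) is in `…CellChainSlot`; the energy representative in `…CellChainEnergy`.
NOT a proof of any registered stub, of the crux, or of anomalous dissipation; rung F-D1.A0 infrastructure.
-/

set_option linter.dupNamespace false

noncomputable section

namespace Summit.AnomalousDissipation.AnomalousDissipation.Theorems.SolenoidalFractalHomogenisation.LagrangianStep.CellChain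

open Set MeasureTheory Filter Topology Function Complex UnitAddTorus
open scoped InnerProductSpace ComplexConjugate
open Literature.Analysis Literature.Analysis.FunctionSpaces Literature.Analysis.FunctionSpaces.Torus
open Literature.Analysis.FluidPDE Literature.Analysis.FluidPDE.Torus Literature.Analysis.FluidPDE.LatticeShear
open Summit.AnomalousDissipation.AnomalousDissipation.Theorems.SolenoidalFractalHomogenisation.RealisedQuasiStaticCellLaw
open Summit.AnomalousDissipation.AnomalousDissipation.Theorems.SolenoidalFractalHomogenisation.PermissibleCarrier

variable {k₀ : ℕ}

/-! ## §1 Algebra of the chain right-hand side -/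

/-- The link coefficient is purely imaginary: `conj (linkCoeff) = −linkCoeff`. [cite: MeshalkinSinai1961, pp. 1700–1705] -/
theorem conj_linkCoeff (W₁ : LatticeWord k₀) (n : ℕ) (k : Fin 3 → ℤ) (j : Fin k₀) (τ : ℝ) :
    conj (linkCoeff W₁ n k j τ) = -linkCoeff W₁ n k j τ := by
  rw [linkCoeff_def]
  simp only [map_mul, map_sum, Complex.conj_ofReal, map_intCast, Complex.conj_I]
  have h2 : conj (2 : ℂ) = 2 := by rw [show (2 : ℂ) = ((2 : ℝ) : ℂ) by norm_num, Complex.conj_ofReal]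
  rw [h2]
  ring

/-- `P_k` maps into the transversal subspace, for every `k` (for `k = 0` trivially). [cite: Temam1984, Ch. III §1.1] -/
theorem kdot_transversalProj' (k : Fin 3 → ℤ) (z : EuclideanSpace ℂ (Fin 3)) : kdot k (transversalProj k z) = 0 := by
  by_cases hk : k = 0
  · subst hk
    rw [kdot_apply]
    simp
  · exact kdot_transversalProj hk z

/-- `P_k` is self-adjoint in the form used here: `⟪P_k x, z⟫ = ⟪x, z⟫` for transversal `z`. [cite: Temam1984, Ch. III §1.1] -/
theorem inner_transversalProj_left_of_kdot_eq_zero (k : Fin 3 → ℤ) {z : EuclideanSpace ℂ (Fin 3)} (hz : kdot k z = 0)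
    (x : EuclideanSpace ℂ (Fin 3)) : ⟪transversalProj k x, z⟫_ℂ = ⟪x, z⟫_ℂ := by
  rw [← inner_conj_symm, inner_transversalProj_right_of_kdot_eq_zero k hz x, inner_conj_symm]

/-- **The chain right-hand side is transversal**: `k · modeRHS … k τ = 0`. [cite: Temam1984, Ch. III §1.1] -/
theorem kdot_modeRHS (W₁ : LatticeWord k₀) (n : ℕ) (𝔹 : Torus.Visc4 (Fin 3)) (u : ℝ → UnitAddTorus (Fin 3) → EuclideanSpace ℝ (Fin 3))
    (k : Fin 3 → ℤ) (τ : ℝ) : kdot k (modeRHS W₁ n 𝔹 u k τ) = 0 := by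
  rw [modeRHS_def, map_sub, map_neg, map_smul, kdot_transversalProj', smul_zero, neg_zero, map_sum]
  simp only [map_smul, kdot_transversalProj', smul_zero, Finset.sum_const_zero, sub_zero]

/-- **Pairing of the chain right-hand side with a transversal vector** is the scalar integrand of the chain identity
`CellChainLinks.ae_inner_mFourierCoeff_eq_cell`:
`⟪modeRHS … k τ, z⟫ = −4π² ⟪û(τ)(k), T_𝔹(k) z⟫ + Σⱼ linkCoeffⱼ(k,τ)·(a′ⱼ ⟪û(τ)(k − Kⱼ), z⟫ + aⱼ ⟪û(τ)(k + Kⱼ), z⟫)` (`k · z = 0`).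
[cite: MeshalkinSinai1961, pp. 1700–1705] [cite: Frisch1995Turbulence, §9.6.3 eq. (9.57) p. 233] -/
theorem inner_modeRHS_eq (W₁ : LatticeWord k₀) (n : ℕ) (𝔹 : Torus.Visc4 (Fin 3)) (u : ℝ → UnitAddTorus (Fin 3) → EuclideanSpace ℝ (Fin 3))
    (k : Fin 3 → ℤ) (τ : ℝ) {z : EuclideanSpace ℂ (Fin 3)} (hz : kdot k z = 0) :
    ⟪modeRHS W₁ n 𝔹 u k τ, z⟫_ℂ =
      (-(4 * Real.pi ^ 2 : ℝ) : ℂ) * ⟪mFourierCoeff (EuclideanSpace.complexify ∘ u τ) k, Torus.symbT 𝔹 k z⟫_ℂ +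
        ∑ j, linkCoeff W₁ n k j τ *
          ((starRingEnd ℂ (Complex.exp ((W₁.phase j).φ * Complex.I)) *
                (-(1 / (2 * ((2 * Real.pi * ‖latticeVec (W₁.phase j).m‖ : ℝ) : ℂ) * Complex.I)))) *
              ⟪mFourierCoeff (EuclideanSpace.complexify ∘ u τ) (k - fun i => (W₁.phase j).m i * n), z⟫_ℂ +
            (Complex.exp ((W₁.phase j).φ * Complex.I) * (1 / (2 * ((2 * Real.pi * ‖latticeVec (W₁.phase j).m‖ : ℝ) : ℂ) * Complex.I))) *
              ⟪mFourierCoeff (EuclideanSpace.complexify ∘ u τ) (k + fun i => (W₁.phase j).m i * n), z⟫_ℂ) := by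
  rw [modeRHS_def, inner_sub_left, inner_neg_left, inner_smul_left, inner_transversalProj_left_of_kdot_eq_zero k hz,
    inner_symbT_majorTranspose_left, sum_inner, Complex.conj_ofReal]
  have hj : ∀ j : Fin k₀,
      ⟪linkCoeff W₁ n k j τ • transversalProj k
          ((Complex.exp ((W₁.phase j).φ * Complex.I) * (1 / (2 * ((2 * Real.pi * ‖latticeVec (W₁.phase j).m‖ : ℝ) : ℂ) * Complex.I))) •
              mFourierCoeff (EuclideanSpace.complexify ∘ u τ) (k - fun i => (W₁.phase j).m i * n) +
            (starRingEnd ℂ (Complex.exp ((W₁.phase j).φ * Complex.I)) *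
                (-(1 / (2 * ((2 * Real.pi * ‖latticeVec (W₁.phase j).m‖ : ℝ) : ℂ) * Complex.I)))) •
              mFourierCoeff (EuclideanSpace.complexify ∘ u τ) (k + fun i => (W₁.phase j).m i * n)), z⟫_ℂ =
        -(linkCoeff W₁ n k j τ *
          ((starRingEnd ℂ (Complex.exp ((W₁.phase j).φ * Complex.I)) *
                (-(1 / (2 * ((2 * Real.pi * ‖latticeVec (W₁.phase j).m‖ : ℝ) : ℂ) * Complex.I)))) *
              ⟪mFourierCoeff (EuclideanSpace.complexify ∘ u τ) (k - fun i => (W₁.phase j).m i * n), z⟫_ℂ +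
            (Complex.exp ((W₁.phase j).φ * Complex.I) * (1 / (2 * ((2 * Real.pi * ‖latticeVec (W₁.phase j).m‖ : ℝ) : ℂ) * Complex.I))) *
              ⟪mFourierCoeff (EuclideanSpace.complexify ∘ u τ) (k + fun i => (W₁.phase j).m i * n), z⟫_ℂ)) := by
    intro j
    rw [inner_smul_left, conj_linkCoeff, inner_transversalProj_left_of_kdot_eq_zero k hz, inner_add_left, inner_smul_left,
      inner_smul_left, layerAmp_conj, layerAmp'_conj]
    ring
  simp only [hj, Finset.sum_neg_distrib, sub_neg_eq_add]
  ring

/-! ## §2 Integrability of the chain right-hand side on `(0,T)` -/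

/-- The link coefficient is continuous in time (the envelope is continuous across the period). [folklore] -/
theorem continuous_linkCoeff (W₁ : LatticeWord k₀) (n : ℕ) (k : Fin 3 → ℤ) (j : Fin k₀) : Continuous (linkCoeff W₁ n k j) := by
  have h := continuous_trapezoid_fract W₁ j 1
  simp only [one_mul] at h
  unfold linkCoeff
  exact continuous_const.mul (Complex.continuous_ofReal.comp (continuous_const.mul h))

/-- The link coefficient is bounded: `‖linkCoeff‖ ≤ 2π·|êⱼ·k|·(1/n)` (the envelope takes values in `[0,1]`). [folklore] -/
theorem norm_linkCoeff_le (W₁ : LatticeWord k₀) (n : ℕ) (k : Fin 3 → ℤ) (j : Fin k₀) (τ : ℝ) :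
    ‖linkCoeff W₁ n k j τ‖ ≤ 2 * Real.pi * ‖∑ a, ((W₁.phase j).e a : ℂ) * (k a)‖ * (1 / (n : ℝ)) := by
  rw [linkCoeff_def, norm_mul, norm_mul, norm_mul, norm_mul, Complex.norm_real, Complex.norm_I, mul_one, Complex.norm_real,
    Real.norm_eq_abs, abs_of_pos Real.pi_pos]
  have h2 : ‖(2 : ℂ)‖ = 2 := by simp
  rw [h2]
  have htrap : LatticeWord.trapezoid (W₁.start j) (W₁.phase j).τ W₁.ramp (Int.fract (τ / W₁.period) * W₁.period) ∈ Icc (0:ℝ) 1 :=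
    ⟨trapezoid_nonneg _ _ _ _, trapezoid_le_one _ _ _ _⟩
  have hn : 0 ≤ (1 / (n : ℝ)) := by positivity
  have hb : ‖(1 / (n : ℝ)) * LatticeWord.trapezoid (W₁.start j) (W₁.phase j).τ W₁.ramp (Int.fract (τ / W₁.period) * W₁.period)‖ ≤
      1 / (n : ℝ) := by
    rw [Real.norm_eq_abs, abs_of_nonneg (mul_nonneg hn htrap.1)]
    calc (1 / (n : ℝ)) * _ ≤ (1 / (n : ℝ)) * 1 := mul_le_mul_of_nonneg_left htrap.2 hn
      _ = 1 / (n : ℝ) := mul_one _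
  have h0 : 0 ≤ 2 * Real.pi * ‖∑ a, ((W₁.phase j).e a : ℂ) * (k a)‖ := by positivity
  exact mul_le_mul_of_nonneg_left hb h0

/-- **The chain right-hand side of a weak solution is integrable on `(0,T)`.** [cite: DiPernaLions1989, §II.1 (12)–(14)] -/
theorem integrableOn_modeRHS (W₁ : LatticeWord k₀) (n : ℕ) {T : ℝ} {𝔹 : Torus.Visc4 (Fin 3)}
    {F : UnitAddTorus (Fin 3) → EuclideanSpace ℝ (Fin 3)} {u : ℝ → UnitAddTorus (Fin 3) → EuclideanSpace ℝ (Fin 3)}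
    (h : Torus.IsWeakTensorPassiveVectorOn 0 T 𝔹 (W₁.cell n) F u) (k : Fin 3 → ℤ) :
    IntegrableOn (modeRHS W₁ n 𝔹 u k) (Ioo 0 T) volume := by
  have hm : ∀ k', Integrable (fun τ => mFourierCoeff (EuclideanSpace.complexify ∘ u τ) k') (volume.restrict (Ioo 0 T)) :=
    fun k' => h.integrableOn_mFourierCoeff k'
  -- the viscous part: a continuous linear image of the mode
  have hvisc : Integrable (fun τ => -(((4 * Real.pi ^ 2 : ℝ) : ℂ) • transversalProj k
      (Torus.symbT (Torus.majorTranspose 𝔹) k (mFourierCoeff (EuclideanSpace.complexify ∘ u τ) k)))) (volume.restrict (Ioo 0 T)) := by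
    have h1 := ((transversalProj k).comp (symbTL (Torus.majorTranspose 𝔹) k)).integrable_comp (hm k)
    exact (h1.smul (((4 * Real.pi ^ 2 : ℝ) : ℂ))).neg
  -- the link part: bounded continuous scalar times a continuous linear image of the neighbouring modes
  have hlink : ∀ j : Fin k₀, Integrable (fun τ => linkCoeff W₁ n k j τ • transversalProj k
      ((Complex.exp ((W₁.phase j).φ * Complex.I) * (1 / (2 * ((2 * Real.pi * ‖latticeVec (W₁.phase j).m‖ : ℝ) : ℂ) * Complex.I))) •
          mFourierCoeff (EuclideanSpace.complexify ∘ u τ) (k - fun i => (W₁.phase j).m i * n) +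
        (starRingEnd ℂ (Complex.exp ((W₁.phase j).φ * Complex.I)) *
            (-(1 / (2 * ((2 * Real.pi * ‖latticeVec (W₁.phase j).m‖ : ℝ) : ℂ) * Complex.I)))) •
          mFourierCoeff (EuclideanSpace.complexify ∘ u τ) (k + fun i => (W₁.phase j).m i * n))) (volume.restrict (Ioo 0 T)) := by
    intro j
    have hA : Integrable (fun τ =>
        (Complex.exp ((W₁.phase j).φ * Complex.I) * (1 / (2 * ((2 * Real.pi * ‖latticeVec (W₁.phase j).m‖ : ℝ) : ℂ) * Complex.I))) •
          mFourierCoeff (EuclideanSpace.complexify ∘ u τ) (k - fun i => (W₁.phase j).m i * n)) (volume.restrict (Ioo 0 T)) :=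
      (hm (k - fun i => (W₁.phase j).m i * n)).smul
        (Complex.exp ((W₁.phase j).φ * Complex.I) * (1 / (2 * ((2 * Real.pi * ‖latticeVec (W₁.phase j).m‖ : ℝ) : ℂ) * Complex.I)))
    have hB : Integrable (fun τ =>
        (starRingEnd ℂ (Complex.exp ((W₁.phase j).φ * Complex.I)) *
            (-(1 / (2 * ((2 * Real.pi * ‖latticeVec (W₁.phase j).m‖ : ℝ) : ℂ) * Complex.I)))) •
          mFourierCoeff (EuclideanSpace.complexify ∘ u τ) (k + fun i => (W₁.phase j).m i * n)) (volume.restrict (Ioo 0 T)) :=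
      (hm (k + fun i => (W₁.phase j).m i * n)).smul
        (starRingEnd ℂ (Complex.exp ((W₁.phase j).φ * Complex.I)) *
            (-(1 / (2 * ((2 * Real.pi * ‖latticeVec (W₁.phase j).m‖ : ℝ) : ℂ) * Complex.I))))
    have h1 := (transversalProj k).integrable_comp (hA.add hB)
    have h2 := h1.bdd_smul (2 * Real.pi * ‖∑ a, ((W₁.phase j).e a : ℂ) * (k a)‖ * (1 / (n : ℝ)))
      (continuous_linkCoeff W₁ n k j).aestronglyMeasurable (Eventually.of_forall fun τ => norm_linkCoeff_le W₁ n k j τ)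
    exact h2
  have hsum := integrable_finsetSum Finset.univ fun j (_ : j ∈ Finset.univ) => hlink j
  have e : modeRHS W₁ n 𝔹 u k = fun τ => -(((4 * Real.pi ^ 2 : ℝ) : ℂ) • transversalProj k
      (Torus.symbT (Torus.majorTranspose 𝔹) k (mFourierCoeff (EuclideanSpace.complexify ∘ u τ) k))) -
      ∑ j, linkCoeff W₁ n k j τ • transversalProj k
        ((Complex.exp ((W₁.phase j).φ * Complex.I) * (1 / (2 * ((2 * Real.pi * ‖latticeVec (W₁.phase j).m‖ : ℝ) : ℂ) * Complex.I))) •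
            mFourierCoeff (EuclideanSpace.complexify ∘ u τ) (k - fun i => (W₁.phase j).m i * n) +
          (starRingEnd ℂ (Complex.exp ((W₁.phase j).φ * Complex.I)) *
              (-(1 / (2 * ((2 * Real.pi * ‖latticeVec (W₁.phase j).m‖ : ℝ) : ℂ) * Complex.I)))) •
            mFourierCoeff (EuclideanSpace.complexify ∘ u τ) (k + fun i => (W₁.phase j).m i * n)) := by
    funext τ; rw [modeRHS_def]
  rw [IntegrableOn, e]
  exact hvisc.sub (by simpa only [Finset.sum_apply] using hsum)

/-- The chain right-hand side is interval-integrable on `[0,T]`. [cite: DiPernaLions1989, §II.1 (12)–(14)] -/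
theorem intervalIntegrable_modeRHS (W₁ : LatticeWord k₀) (n : ℕ) {T : ℝ} (hT : 0 ≤ T) {𝔹 : Torus.Visc4 (Fin 3)}
    {F : UnitAddTorus (Fin 3) → EuclideanSpace ℝ (Fin 3)} {u : ℝ → UnitAddTorus (Fin 3) → EuclideanSpace ℝ (Fin 3)}
    (h : Torus.IsWeakTensorPassiveVectorOn 0 T 𝔹 (W₁.cell n) F u) (k : Fin 3 → ℤ) :
    IntervalIntegrable (modeRHS W₁ n 𝔹 u k) volume 0 T :=
  (intervalIntegrable_iff_integrableOn_Ioo_of_le hT).2 (integrableOn_modeRHS W₁ n h k)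


/-! ## §3 The continuous representative of a mode -/

/-- **The representative is continuous on `[0,T]`** (primitive of an integrable function). [cite: Temam1984, Ch. III §1.1] -/
theorem continuousOn_modeRep (W₁ : LatticeWord k₀) (n : ℕ) {T : ℝ} (hT : 0 ≤ T) {𝔹 : Torus.Visc4 (Fin 3)}
    {F : UnitAddTorus (Fin 3) → EuclideanSpace ℝ (Fin 3)} {u : ℝ → UnitAddTorus (Fin 3) → EuclideanSpace ℝ (Fin 3)}
    (h : Torus.IsWeakTensorPassiveVectorOn 0 T 𝔹 (W₁.cell n) F u) (k : Fin 3 → ℤ) :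
    ContinuousOn (modeRep W₁ n 𝔹 F u k) (Icc 0 T) := by
  have hi : IntegrableOn (modeRHS W₁ n 𝔹 u k) (uIcc 0 T) volume := by
    rw [uIcc_of_le hT, integrableOn_Icc_iff_integrableOn_Ioo]
    exact integrableOn_modeRHS W₁ n h k
  have hc := intervalIntegral.continuousOn_primitive_interval (μ := volume) hi
  rw [uIcc_of_le hT] at hc
  exact continuousOn_const.add hc

/-- **The representative is transversal**: `k · modeRep … k t = 0` for `t ∈ [0,T]`. [cite: Temam1984, Ch. III §1.1] -/
theorem kdot_modeRep (W₁ : LatticeWord k₀) (n : ℕ) {T : ℝ} (hT : 0 ≤ T) {𝔹 : Torus.Visc4 (Fin 3)}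
    {F : UnitAddTorus (Fin 3) → EuclideanSpace ℝ (Fin 3)} {u : ℝ → UnitAddTorus (Fin 3) → EuclideanSpace ℝ (Fin 3)}
    (h : Torus.IsWeakTensorPassiveVectorOn 0 T 𝔹 (W₁.cell n) F u) (k : Fin 3 → ℤ) {t : ℝ} (ht : t ∈ Icc 0 T) :
    kdot k (modeRep W₁ n 𝔹 F u k t) = 0 := by
  rw [modeRep_def, map_add, kdot_transversalProj', zero_add]
  have hi : IntervalIntegrable (modeRHS W₁ n 𝔹 u k) volume 0 t :=
    (intervalIntegrable_modeRHS W₁ n hT h k).mono_set (by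
      rw [uIcc_of_le hT, uIcc_of_le ht.1]; exact Icc_subset_Icc_right ht.2)
  have hc := (LinearMap.toContinuousLinearMap (kdot k)).intervalIntegral_comp_comm hi
  simp only [LinearMap.coe_toContinuousLinearMap', kdot_modeRHS, intervalIntegral.integral_zero] at hc
  exact hc.symm

/-- **THE VECTOR CHAIN IDENTITY**: the a.e.-defined mode `t ↦ û(t)(k)` of a weak solution of the flat tensor cell problem coincides a.e. on `(0,T)`
with its continuous representative `modeRep … k` (`= P_k F̂(k) + ∫₀ᵗ modeRHS`).  Proof: both are transversal, and their pairings with the three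
transversal vectors `P_k eᵢ` agree a.e. by the scalar chain identity `CellChainLinks.ae_inner_mFourierCoeff_eq_cell` + `inner_modeRHS_eq`.
[cite: Temam1984, Ch. III §1.1] [cite: MeshalkinSinai1961, pp. 1700–1705] -/
theorem ae_eq_modeRep (W₁ : LatticeWord k₀) (n : ℕ) {T : ℝ} (hT : 0 ≤ T) {𝔹 : Torus.Visc4 (Fin 3)}
    {F : UnitAddTorus (Fin 3) → EuclideanSpace ℝ (Fin 3)} {u : ℝ → UnitAddTorus (Fin 3) → EuclideanSpace ℝ (Fin 3)}
    (h : Torus.IsWeakTensorPassiveVectorOn 0 T 𝔹 (W₁.cell n) F u) (hF : Integrable F volume) (k : Fin 3 → ℤ) :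
    ∀ᵐ t ∂(volume.restrict (Ioo 0 T)), mFourierCoeff (EuclideanSpace.complexify ∘ u t) k = modeRep W₁ n 𝔹 F u k t := by
  -- the scalar identities against the transversal vectors `P_k eᵢ`
  have hsc : ∀ i : Fin 3, ∀ᵐ t ∂(volume.restrict (Ioo 0 T)),
      ⟪mFourierCoeff (EuclideanSpace.complexify ∘ u t) k, transversalProj k (EuclideanSpace.single i (1:ℂ))⟫_ℂ =
        ⟪modeRep W₁ n 𝔹 F u k t, transversalProj k (EuclideanSpace.single i (1:ℂ))⟫_ℂ := by
    intro i
    have hz : kdot k (transversalProj k (EuclideanSpace.single i (1:ℂ))) = 0 := kdot_transversalProj' k _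
    have hz' : ∑ j, (k j : ℂ) * (transversalProj k (EuclideanSpace.single i (1:ℂ))) j = 0 := by
      rw [← kdot_apply]; exact hz
    have h1 := ae_inner_mFourierCoeff_eq_cell W₁ n h hF k hz'
    filter_upwards [h1, ae_restrict_mem measurableSet_Ioo] with t ht htT
    rw [ht, modeRep_def, inner_add_left, inner_transversalProj_left_of_kdot_eq_zero k hz,
      intervalIntegral.integral_of_le htT.1.le]
    congr 1
    have hi : Integrable (modeRHS W₁ n 𝔹 u k) (volume.restrict (Ioc 0 t)) :=
      (integrableOn_modeRHS W₁ n h k).mono_set (Ioc_subset_Ioo_right htT.2)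
    rw [← inner_conj_symm, ← integral_inner hi, ← integral_conj]
    refine (setIntegral_congr_fun measurableSet_Ioc fun τ _ => ?_).symm
    rw [inner_conj_symm, inner_modeRHS_eq W₁ n 𝔹 u k τ hz]
    simp only [linkCoeff_def]
  have hsc' : ∀ᵐ t ∂(volume.restrict (Ioo 0 T)), ∀ i : Fin 3,
      ⟪mFourierCoeff (EuclideanSpace.complexify ∘ u t) k, transversalProj k (EuclideanSpace.single i (1:ℂ))⟫_ℂ =
        ⟪modeRep W₁ n 𝔹 F u k t, transversalProj k (EuclideanSpace.single i (1:ℂ))⟫_ℂ := ae_all_iff.2 hsc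
  filter_upwards [hsc', h.ae_sum_mul_mFourierCoeff_eq_zero k, ae_restrict_mem measurableSet_Ioo] with t hall hkt htT
  set D : EuclideanSpace ℂ (Fin 3) := mFourierCoeff (EuclideanSpace.complexify ∘ u t) k - modeRep W₁ n 𝔹 F u k t with hD_def
  have hD : kdot k D = 0 := by
    rw [hD_def, map_sub, kdot_apply, hkt, kdot_modeRep W₁ n hT h k ⟨htT.1.le, htT.2.le⟩, sub_zero]
  have hDi : ∀ i : Fin 3, ⟪D, EuclideanSpace.single i (1:ℂ)⟫_ℂ = 0 := by
    intro i
    have hP : ⟪D, transversalProj k (EuclideanSpace.single i (1:ℂ))⟫_ℂ = 0 := by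
      rw [hD_def, inner_sub_left, sub_eq_zero]
      exact hall i
    have hrest : ⟪D, EuclideanSpace.single i (1:ℂ) - transversalProj k (EuclideanSpace.single i (1:ℂ))⟫_ℂ = 0 := by
      rw [transversalProj_apply, sub_sub_cancel, inner_smul_right, ← inner_conj_symm, inner_waveVecC_left, hD, map_zero, mul_zero]
    calc ⟪D, EuclideanSpace.single i (1:ℂ)⟫_ℂ
        = ⟪D, transversalProj k (EuclideanSpace.single i (1:ℂ))⟫_ℂ +
            ⟪D, EuclideanSpace.single i (1:ℂ) - transversalProj k (EuclideanSpace.single i (1:ℂ))⟫_ℂ := by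
          rw [← inner_add_right, add_sub_cancel]
      _ = 0 := by rw [hP, hrest, add_zero]
  have hD0 : D = 0 := by
    ext i
    have hi := hDi i
    rw [EuclideanSpace.inner_single_right, one_mul] at hi
    simpa using hi
  exact sub_eq_zero.1 hD0

/-- All modes at once: for a.e. `t ∈ (0,T)`, `û(t)(k) = modeRep … k t` for EVERY `k` (countably many modes). [cite: Temam1984, Ch. III §1.1] -/
theorem ae_forall_eq_modeRep (W₁ : LatticeWord k₀) (n : ℕ) {T : ℝ} (hT : 0 ≤ T) {𝔹 : Torus.Visc4 (Fin 3)}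
    {F : UnitAddTorus (Fin 3) → EuclideanSpace ℝ (Fin 3)} {u : ℝ → UnitAddTorus (Fin 3) → EuclideanSpace ℝ (Fin 3)}
    (h : Torus.IsWeakTensorPassiveVectorOn 0 T 𝔹 (W₁.cell n) F u) (hF : Integrable F volume) :
    ∀ᵐ t ∂(volume.restrict (Ioo 0 T)), ∀ k, mFourierCoeff (EuclideanSpace.complexify ∘ u t) k = modeRep W₁ n 𝔹 F u k t :=
  ae_all_iff.2 fun k => ae_eq_modeRep W₁ n hT h hF k

/-- **THE CHAIN ODE AS AN a.e. DERIVATIVE**: for a.e. `t ∈ (0,T)`, `HasDerivAt (modeRep … k) (modeRHS … k t) t`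
(Lebesgue differentiation of the primitive of the integrable chain right-hand side). [cite: Temam1984, Ch. III §1.1] -/
theorem ae_hasDerivAt_modeRep (W₁ : LatticeWord k₀) (n : ℕ) {T : ℝ} (hT : 0 ≤ T) {𝔹 : Torus.Visc4 (Fin 3)}
    {F : UnitAddTorus (Fin 3) → EuclideanSpace ℝ (Fin 3)} {u : ℝ → UnitAddTorus (Fin 3) → EuclideanSpace ℝ (Fin 3)}
    (h : Torus.IsWeakTensorPassiveVectorOn 0 T 𝔹 (W₁.cell n) F u) (k : Fin 3 → ℤ) :
    ∀ᵐ t ∂(volume : Measure ℝ), t ∈ Ioo 0 T → HasDerivAt (modeRep W₁ n 𝔹 F u k) (modeRHS W₁ n 𝔹 u k t) t := by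
  have hL := (intervalIntegrable_modeRHS W₁ n hT h k).ae_hasDerivAt_integral
  filter_upwards [hL] with t ht htI
  have h0 : (0:ℝ) ∈ uIcc 0 T := by rw [uIcc_of_le hT]; exact ⟨le_rfl, hT⟩
  have ht' : t ∈ uIcc 0 T := by rw [uIcc_of_le hT]; exact ⟨htI.1.le, htI.2.le⟩
  exact (ht ht' 0 h0).const_add _

/-- The same in the `volume.restrict (Ioo 0 T)` form. [cite: Temam1984, Ch. III §1.1] -/
theorem ae_restrict_hasDerivAt_modeRep (W₁ : LatticeWord k₀) (n : ℕ) {T : ℝ} (hT : 0 ≤ T) {𝔹 : Torus.Visc4 (Fin 3)}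
    {F : UnitAddTorus (Fin 3) → EuclideanSpace ℝ (Fin 3)} {u : ℝ → UnitAddTorus (Fin 3) → EuclideanSpace ℝ (Fin 3)}
    (h : Torus.IsWeakTensorPassiveVectorOn 0 T 𝔹 (W₁.cell n) F u) (k : Fin 3 → ℤ) :
    ∀ᵐ t ∂(volume.restrict (Ioo 0 T)), HasDerivAt (modeRep W₁ n 𝔹 F u k) (modeRHS W₁ n 𝔹 u k t) t :=
  (ae_restrict_iff' measurableSet_Ioo).2 (ae_hasDerivAt_modeRep W₁ n hT h k)

/-- The chain right-hand side read on the representatives (a pointwise rewriting, valid wherever all modes agree with their representatives).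
[cite: MeshalkinSinai1961, pp. 1700–1705] -/
theorem modeRHS_eq_of_forall_eq (W₁ : LatticeWord k₀) (n : ℕ) (𝔹 : Torus.Visc4 (Fin 3))
    (F : UnitAddTorus (Fin 3) → EuclideanSpace ℝ (Fin 3)) (u : ℝ → UnitAddTorus (Fin 3) → EuclideanSpace ℝ (Fin 3)) {t : ℝ}
    (hrep : ∀ k, mFourierCoeff (EuclideanSpace.complexify ∘ u t) k = modeRep W₁ n 𝔹 F u k t) (k : Fin 3 → ℤ) :
    modeRHS W₁ n 𝔹 u k t =
      -(((4 * Real.pi ^ 2 : ℝ) : ℂ) • transversalProj k (Torus.symbT (Torus.majorTranspose 𝔹) k (modeRep W₁ n 𝔹 F u k t))) -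
        ∑ j, linkCoeff W₁ n k j t • transversalProj k
          ((Complex.exp ((W₁.phase j).φ * Complex.I) * (1 / (2 * ((2 * Real.pi * ‖latticeVec (W₁.phase j).m‖ : ℝ) : ℂ) * Complex.I))) •
              modeRep W₁ n 𝔹 F u (k - fun i => (W₁.phase j).m i * n) t +
            (starRingEnd ℂ (Complex.exp ((W₁.phase j).φ * Complex.I)) *
                (-(1 / (2 * ((2 * Real.pi * ‖latticeVec (W₁.phase j).m‖ : ℝ) : ℂ) * Complex.I)))) •
              modeRep W₁ n 𝔹 F u (k + fun i => (W₁.phase j).m i * n) t) := by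
  simp only [modeRHS_def, hrep]

/-- **The closed countable ODE system, a.e.**: for a.e. `t ∈ (0,T)`, every representative is differentiable at `t` with derivative the chain
right-hand side READ ON THE REPRESENTATIVES. [cite: MeshalkinSinai1961, pp. 1700–1705] [cite: Temam1984, Ch. III §1.1] -/
theorem ae_hasDerivAt_modeRep_rep (W₁ : LatticeWord k₀) (n : ℕ) {T : ℝ} (hT : 0 ≤ T) {𝔹 : Torus.Visc4 (Fin 3)}
    {F : UnitAddTorus (Fin 3) → EuclideanSpace ℝ (Fin 3)} {u : ℝ → UnitAddTorus (Fin 3) → EuclideanSpace ℝ (Fin 3)}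
    (h : Torus.IsWeakTensorPassiveVectorOn 0 T 𝔹 (W₁.cell n) F u) (hF : Integrable F volume) :
    ∀ᵐ t ∂(volume.restrict (Ioo 0 T)), ∀ k, HasDerivAt (modeRep W₁ n 𝔹 F u k)
      (-(((4 * Real.pi ^ 2 : ℝ) : ℂ) • transversalProj k (Torus.symbT (Torus.majorTranspose 𝔹) k (modeRep W₁ n 𝔹 F u k t))) -
        ∑ j, linkCoeff W₁ n k j t • transversalProj k
          ((Complex.exp ((W₁.phase j).φ * Complex.I) * (1 / (2 * ((2 * Real.pi * ‖latticeVec (W₁.phase j).m‖ : ℝ) : ℂ) * Complex.I))) •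
              modeRep W₁ n 𝔹 F u (k - fun i => (W₁.phase j).m i * n) t +
            (starRingEnd ℂ (Complex.exp ((W₁.phase j).φ * Complex.I)) *
                (-(1 / (2 * ((2 * Real.pi * ‖latticeVec (W₁.phase j).m‖ : ℝ) : ℂ) * Complex.I)))) •
              modeRep W₁ n 𝔹 F u (k + fun i => (W₁.phase j).m i * n) t)) t := by
  have hd : ∀ᵐ t ∂(volume.restrict (Ioo 0 T)), ∀ k, HasDerivAt (modeRep W₁ n 𝔹 F u k) (modeRHS W₁ n 𝔹 u k t) t :=
    ae_all_iff.2 fun k => ae_restrict_hasDerivAt_modeRep W₁ n hT h k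
  filter_upwards [hd, ae_forall_eq_modeRep W₁ n hT h hF] with t hdt hrep k
  rw [← modeRHS_eq_of_forall_eq W₁ n 𝔹 F u hrep k]
  exact hdt k

/-! ## §4 Finite Bessel and absolute continuity -/

/-- **Finite Bessel, a.e. in time**: `Σ_{k∈S} ‖û(t)(k)‖² ≤ ∫‖u t‖²` for every finite `S` and a.e. `t ∈ (0,T)`. [cite: Grafakos2014, Prop. 3.2.7 (3)] -/
theorem sum_sq_norm_mFourierCoeff_le (W₁ : LatticeWord k₀) (n : ℕ) {T : ℝ} {𝔹 : Torus.Visc4 (Fin 3)}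
    {F : UnitAddTorus (Fin 3) → EuclideanSpace ℝ (Fin 3)} {u : ℝ → UnitAddTorus (Fin 3) → EuclideanSpace ℝ (Fin 3)}
    (h : Torus.IsWeakTensorPassiveVectorOn 0 T 𝔹 (W₁.cell n) F u) (S : Finset (Fin 3 → ℤ)) :
    ∀ᵐ t ∂(volume.restrict (Ioo 0 T)), ∑ k ∈ S, ‖mFourierCoeff (EuclideanSpace.complexify ∘ u t) k‖ ^ 2 ≤ ∫ x, ‖u t x‖ ^ 2 := by
  filter_upwards [h.ae_memLp_two] with t ht
  exact sum_le_hasSum S (fun k _ => sq_nonneg _) (hasSum_sq_norm_mFourierCoeff_complexify ht)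

/-- Dominated absolute continuity: if `dist (g x) (g y) ≤ dist (G x) (G y)` on `uIcc a b` and `G` is absolutely continuous there, so is `g`
(used with `G` = the real primitive of `‖modeRHS‖`). [folklore] -/
theorem absolutelyContinuousOnInterval_of_dist_le {X : Type*} [PseudoMetricSpace X] {g : ℝ → X} {G : ℝ → ℝ} {a b : ℝ}
    (hG : AbsolutelyContinuousOnInterval G a b)
    (hle : ∀ x ∈ uIcc a b, ∀ y ∈ uIcc a b, dist (g x) (g y) ≤ dist (G x) (G y)) :
    AbsolutelyContinuousOnInterval g a b := by
  rw [absolutelyContinuousOnInterval_iff] at hG ⊢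
  intro ε hε
  obtain ⟨δ, hδ, hδ'⟩ := hG ε hε
  refine ⟨δ, hδ, fun E hE hlt => lt_of_le_of_lt (Finset.sum_le_sum fun i hi => ?_) (hδ' E hE hlt)⟩
  exact hle _ (hE.1 i hi).1 _ (hE.1 i hi).2

/-- **The representative is absolutely continuous on every `[a,b] ⊆ [0,T]`** — the regularity consumed by
`AbsolutelyContinuousOnInterval.integral_deriv_eq_sub` (FTC) in the per-slot Grönwall step. [cite: Temam1984, Ch. III §1.1] -/
theorem absolutelyContinuousOnInterval_modeRep (W₁ : LatticeWord k₀) (n : ℕ) {T : ℝ} (hT : 0 ≤ T) {𝔹 : Torus.Visc4 (Fin 3)}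
    {F : UnitAddTorus (Fin 3) → EuclideanSpace ℝ (Fin 3)} {u : ℝ → UnitAddTorus (Fin 3) → EuclideanSpace ℝ (Fin 3)}
    (h : Torus.IsWeakTensorPassiveVectorOn 0 T 𝔹 (W₁.cell n) F u) (k : Fin 3 → ℤ) {a b : ℝ} (ha : a ∈ Icc 0 T) (hb : b ∈ Icc 0 T) :
    AbsolutelyContinuousOnInterval (modeRep W₁ n 𝔹 F u k) a b := by
  have hi := intervalIntegrable_modeRHS W₁ n hT h k
  have h0 : (0:ℝ) ∈ uIcc 0 T := by rw [uIcc_of_le hT]; exact ⟨le_rfl, hT⟩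
  have ha' : a ∈ uIcc 0 T := by rw [uIcc_of_le hT]; exact ha
  have hb' : b ∈ uIcc 0 T := by rw [uIcc_of_le hT]; exact hb
  have hsub : uIcc a b ⊆ uIcc 0 T := uIcc_subset_uIcc ha' hb'
  have hG : AbsolutelyContinuousOnInterval (fun x => ∫ τ in (0:ℝ)..x, ‖modeRHS W₁ n 𝔹 u k τ‖) a b :=
    (hi.norm.absolutelyContinuousOnInterval_intervalIntegral h0).mono hsub
  refine absolutelyContinuousOnInterval_of_dist_le hG fun x hx y hy => ?_
  have hx' : x ∈ uIcc 0 T := hsub hx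
  have hy' : y ∈ uIcc 0 T := hsub hy
  have hix : IntervalIntegrable (modeRHS W₁ n 𝔹 u k) volume 0 x := hi.mono_set (uIcc_subset_uIcc h0 hx')
  have hiy : IntervalIntegrable (modeRHS W₁ n 𝔹 u k) volume 0 y := hi.mono_set (uIcc_subset_uIcc h0 hy')
  rw [modeRep_def, modeRep_def, dist_add_left, dist_eq_norm, Real.dist_eq,
    intervalIntegral.integral_interval_sub_left hix hiy, intervalIntegral.integral_interval_sub_left hix.norm hiy.norm]
  exact intervalIntegral.norm_integral_le_abs_integral_norm

end Summit.AnomalousDissipation.AnomalousDissipation.Theorems.SolenoidalFractalHomogenisation.LagrangianStep.CellChain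

end
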